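/- Free-seat work of WIDTH SEAT 3/3 `ym-line-cbag-p1-w3` (prover-ym-line-cbag-p1-w3-g11-0), route `EguchiKawaiDirectionLadder`
(ideator ym-idea-2, LINE 8), crux `DirectionIncrement` (stmt-QuantumFields-27725): REGISTERED STUB B1
`stub_singleLinkRigidity : SingleLinkRigidity` BY NAME.  The Yang–Mills mass gap is NOT proved by anything here (the route bears on the
barrier-ledger fact `EguchiKawaiBreakdown`, and only once the crux `TripleSmallBallMargin` also closes). -/
import Summits.QuantumFields.YangMills.Theorems.EguchiKawaiDirectionLadderSingleLinkReduction
import Summits.QuantumFields.YangMills.Theorems.EguchiKawaiDirectionLadderHaarOffDiagSmallBall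

/-!
# Route `EguchiKawaiDirectionLadder`, crux `DirectionIncrement` (stmt-QuantumFields-27725): stub B1 `SingleLinkRigidity`

**One-matrix rigidity, `N`-uniform.** For `0 < δ < 1/2` there are `C ≥ 0` and `N₀` such that for every `N ≥ N₀`, every
centre-symmetric `U ∈ U(N)` (`|tr U/N|² ≤ δ`) and every `t > 0`,

  `Haar{W ∈ U(N) : S_R(![U, W]) ≤ t} ≤ exp(N² (((1 − 2δ)/4) log t + C))`.

Assembly of the two halves landed by the width seats of the cell:
* the deterministic reduction and the block choice from centre symmetry (seat w2:
  `singleLinkRigidity_of_blocks_of_offDiagSmallBall`, `blocks_from_centre_symmetry`,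
  `stub_singleLinkRigidity_of_offDiagSmallBall`), and
* the random-matrix input (RMT), the `N`-uniform small-ball bound for the off-diagonal blocks of a Haar unitary
  (this seat: `HaarColumns.haar_offDiagBlockSq_smallBall`, by the column-by-column Gaussian argument
  `…GaussianRatioTail`, `…HaarColumnStep`, `…HaarNestedPattern`, `…HaarOffDiagCombinatorics`, `…HaarOffDiagSmallBall`).

With stub B2 (`stub_fubiniIncrement`, landed) this closes the crux `DirectionIncrement` (file
`EguchiKawaiDirectionLadderDirectionIncrement.lean`).  Nothing here bears on the Yang–Mills mass gap.
-/

set_option autoImplicit false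

noncomputable section

namespace Summit.QuantumFields.YangMills.Theorems.EguchiKawaiDirectionLadder

/-- **STUB B1 of the registered skeleton of crux `DirectionIncrement` (stmt-QuantumFields-27725), proved: `SingleLinkRigidity`** —
one-matrix rigidity with the `N`-uniform exponent `(1 − 2δ)/4`: the reduction to blocks (`stub_singleLinkRigidity_of_offDiagSmallBall`)
fed with the off-diagonal-block small-ball bound `HaarColumns.haar_offDiagBlockSq_smallBall`. [folklore] -/
theorem stub_singleLinkRigidity : SingleLinkRigidity :=
  stub_singleLinkRigidity_of_offDiagSmallBall HaarColumns.haar_offDiagBlockSq_smallBall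

end Summit.QuantumFields.YangMills.Theorems.EguchiKawaiDirectionLadder

end
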